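import Literature.Analysis.FluidPDE.ReflectedGluedField
import Literature.Analysis.FluidPDE.PeriodicCylinderC1HalfImbedding
import Literature.Analysis.FluidPDE.PeriodicCylinderCellTranslates
import HarnessLib

/-!
# Discharge of `ShirotaYanagisawa1993_periodicCylinderLogDivCurlEstimate`

Analysis/FluidPDE proof file (theorems only, no definitions, no named facts): the stationary
logarithmic div–curl estimate in the periodic cylinder,
`Literature.Analysis.FluidPDE.ShirotaYanagisawa1993_periodicCylinderLogDivCurlEstimate`
(`Ferrari1993LogEstimateReduction.lean`; Shirota–Yanagisawa 1993, (15) p. 80 before (17) is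
invoked; Ferrari 1993, Cor. 1 (31) p. 286 with the `L²` term for the harmonic field of the
cylinder), is **proved**: for `L > 0` there is `C` such that for every field `v` smooth on the
closed cylinder, `L`-periodic, divergence free in `{r < 1}` and tangential on `{r = 1}`, with
`‖v‖_{H³(cell)} ≤ n`, `‖v‖_{L²(cell)} ≤ e`, `|curl v| ≤ A` on `{r < 1}`,
`‖Dv(x)‖ ≤ C (e + 1 + (1 + log⁺ n) A)` on `{r < 1}`.

The proof does not follow the printed route (Solonnikov Green matrices up to the curved wall);
it is the argument announced in `LogLipschitzKernelBounds.lean`: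

1. **log-Lipschitz modulus up to the wall** (`norm_sub_le_of_glued_reflection`,
   `ReflectedGluedField.lean`): for `r(x) < 1`, `0 < R ≤ 1/4`, `r(z) < 1`, `0 < |x − z| ≤ R/4`,
   `‖v(x) − v(z)‖ ≤ K (96 A d (1 + log(R/d)) + 30 G d R + c_V V d / R⁴)`, `d = |x − z|`, with
   `G = sup_{r<1} ‖Dv‖` and `V = sup_{r≤1} |v|` — the velocity reflected across the wall by the
   inversion in the cylinder, cut off, and fed into the regularised Biot–Savart identity;
2. **difference quotients to derivatives** (`norm_fderiv_sub_le_of_holderHalf`): by the tree's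
   `C^{1,1/2}` Morrey bound `periodicCylinder_fderiv_holderHalf_norm_le`
   (`‖Dv(x) − Dv(y)‖ ≤ C_M n |x − y|^{1/2}`), `‖Dv(x)(δd) − (v(x + δd) − v(x))‖ ≤ C_M n δ^{3/2}`
   along inward directions `d` (`add_smul_mem_unitCylinder_of_cone`), and a cone of inward
   directions controls the operator norm (`opNorm_le_three_mul_of_cone`);
3. **the sup of `|v|` by the energy and a small multiple of `G`** (`norm_le_of_ball_average`:
   `|v(p)| ≤ C_e e + R₂ G`, mean value inequality over a ball of radius `R₂/2` inside the cylinder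
   next to `p` and `L¹ ≤ L²` on that ball, the ball carrying at most `⌈R₂/L⌉ + 1` cells of energy,
   `lintegral_ball_le_mul_lintegral_cylinderCell`);
4. **absorption**: with `R` and then `R₂` small the coefficients of `G` add up to `≤ 1/2`, so the
   finite `G ≤ C_M n` satisfies `G ≤ 2 · 3 (C_M n δ^{1/2} + 96 K A (1 + log(R/δ)) + c e)`; the
   choice `δ = min(R/4, max(1, n)⁻²)` (Ferrari (72); Shirota–Yanagisawa (21)) gives
   `n δ^{1/2} ≤ 1` and `log(R/δ) ≤ log 4 + 2 log⁺ n`.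

## Mathlib / tree search

Tree (used): `ShirotaYanagisawa1993_periodicCylinderLogDivCurlEstimate` (the target, stated in
`Ferrari1993LogEstimateReduction`), `periodicCylinder_fderiv_holderHalf_norm_le`
(`PeriodicCylinderC1HalfImbedding`), `lintegral_ball_le_mul_lintegral_cylinderCell`
(`PeriodicCylinderCellTranslates`), `norm_sub_le_of_glued_reflection` (`ReflectedGluedField`),
`exists_norm_fderiv_ballCutoff_le` (`BallCutoff`), `integral_regDelta_one_pos`
(`RegularizedNewtonKernel`), `convex_unitCylinder`, `closure_unitCylinder_mem_nhds`.
Mathlib (used): `Convex.norm_image_sub_le_of_norm_fderiv_le`, `ContinuousLinearMap.opNorm_le_bound`,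
`eLpNorm_le_eLpNorm_mul_rpow_measure_univ`, `Measure.addHaar_ball_center`, `le_csSup`, `csSup_le`,
`Real.posLog_eq_log_max_one`, `Real.log_le_log`.

## References

* T. Shirota, T. Yanagisawa, Proc. Japan Acad. 69 (1993) 77–82, (15) and (17) p. 80, (21) p. 81.
  [ShirotaYanagisawa1993]
* A. B. Ferrari, Comm. Math. Phys. 155 (1993) 277–294, Cor. 1 (31) p. 286, (72) p. 293.
  [Ferrari1993]
* J. T. Beale, T. Kato, A. Majda, Comm. Math. Phys. 94 (1984) 61–66 (the whole-space estimate).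
  [BealeKatoMajda1984]
-/

noncomputable section

open MeasureTheory Set Function Filter Metric Real WithLp
open _root_.Topology
open scoped NNReal ENNReal RealInnerProductSpace ContDiff

namespace Literature.Analysis.FluidPDE

open NewtonPotentialHolder Literature.Analysis.FunctionSpaces

/-! ### A cone of directions controls the operator norm -/

/-- **A cone of directions controls the operator norm**: if `‖T d‖ ≤ S` for every unit vector `d`
with `⟨u, d⟩ ≥ 1/2` (`u` a unit vector), then `‖T‖ ≤ 3S` (decompose a unit vector as
`a u + b t`, `t ⊥ u`, and write `t = (d₊ − d₋)/√3` with `d± = u/2 ± (√3/2) t` in the cone).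
[folklore] -/
theorem opNorm_le_three_mul_of_cone {F : Type*} [NormedAddCommGroup F] [NormedSpace ℝ F]
    (T : EuclideanSpace ℝ (Fin 3) →L[ℝ] F) {u : EuclideanSpace ℝ (Fin 3)} (hu : ‖u‖ = 1) {S : ℝ}
    (hS : 0 ≤ S)
    (h : ∀ d : EuclideanSpace ℝ (Fin 3), ‖d‖ = 1 → (1 : ℝ) / 2 ≤ ⟪u, d⟫ → ‖T d‖ ≤ S) :
    ‖T‖ ≤ 3 * S := by
  have huu : ⟪u, u⟫ = 1 := by rw [real_inner_self_eq_norm_sq, hu, one_pow]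
  have hTu : ‖T u‖ ≤ S := h u hu (by rw [huu]; norm_num)
  -- the bound for unit vectors
  have key : ∀ y : EuclideanSpace ℝ (Fin 3), ‖y‖ = 1 → ‖T y‖ ≤ 3 * S := by
    intro y hy
    set a : ℝ := ⟪y, u⟫ with ha
    set t' : EuclideanSpace ℝ (Fin 3) := y - a • u with ht'
    clear_value a t'
    have hat : ⟪t', u⟫ = 0 := by
      rw [ht', inner_sub_left, real_inner_smul_left, huu, mul_one, ha, sub_self]
    have ha1 : |a| ≤ 1 := by
      have := abs_real_inner_le_norm y u
      rwa [hy, hu, one_mul, ← ha] at this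
    have ht'n : ‖t'‖ ^ 2 = 1 - a ^ 2 := by
      have e : ‖t'‖ ^ 2 = ⟪t', t'⟫ := (real_inner_self_eq_norm_sq t').symm
      rw [e, ht', inner_sub_left, inner_sub_right, inner_sub_right, real_inner_smul_left,
        real_inner_smul_right, real_inner_smul_left, real_inner_smul_right, huu,
        real_inner_self_eq_norm_sq, hy, real_inner_comm y u, ← ha]
      ring
    have ht'1 : ‖t'‖ ≤ 1 := by
      have h0 : ‖t'‖ ^ 2 ≤ 1 := by rw [ht'n]; nlinarith [sq_nonneg a]
      exact (sq_le_one_iff₀ (norm_nonneg _)).1 h0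
    have hydec : y = a • u + t' := by rw [ht']; abel
    by_cases ht0 : t' = 0
    · rw [hydec, ht0, add_zero, map_smul, norm_smul, Real.norm_eq_abs]
      calc |a| * ‖T u‖ ≤ 1 * S := mul_le_mul ha1 hTu (norm_nonneg _) zero_le_one
        _ ≤ 3 * S := by linarith
    · have htpos : 0 < ‖t'‖ := norm_pos_iff.2 ht0
      set t : EuclideanSpace ℝ (Fin 3) := ‖t'‖⁻¹ • t' with ht
      clear_value t
      have htn : ‖t‖ = 1 := by
        rw [ht, norm_smul, norm_inv, norm_norm, inv_mul_cancel₀ htpos.ne']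
      have htu : ⟪u, t⟫ = 0 := by
        rw [ht, real_inner_smul_right, real_inner_comm, hat, mul_zero]
      have htt : ⟪t, t⟫ = 1 := by rw [real_inner_self_eq_norm_sq, htn, one_pow]
      set s3 : ℝ := Real.sqrt 3 with hs3
      have hs3sq : s3 ^ 2 = 3 := by rw [hs3]; exact Real.sq_sqrt (by norm_num)
      have hs3pos : 0 < s3 := by rw [hs3]; exact Real.sqrt_pos.2 (by norm_num)
      have hs3one : 1 ≤ s3 := by
        rw [hs3]
        calc (1 : ℝ) = Real.sqrt 1 := Real.sqrt_one.symm
          _ ≤ Real.sqrt 3 := Real.sqrt_le_sqrt (by norm_num)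
      clear_value s3
      set dp : EuclideanSpace ℝ (Fin 3) := (1 / 2 : ℝ) • u + (s3 / 2) • t with hdp
      set dm : EuclideanSpace ℝ (Fin 3) := (1 / 2 : ℝ) • u - (s3 / 2) • t with hdm
      clear_value dp dm
      have hnorm : ∀ σ : ℝ, σ ^ 2 = 1 → ‖(1 / 2 : ℝ) • u + (σ * (s3 / 2)) • t‖ = 1 := by
        intro σ hσ
        have e : ‖(1 / 2 : ℝ) • u + (σ * (s3 / 2)) • t‖ ^ 2 = 1 := by
          rw [← real_inner_self_eq_norm_sq, inner_add_left, inner_add_right, inner_add_right,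
            real_inner_smul_left, real_inner_smul_right, real_inner_smul_left, real_inner_smul_right,
            real_inner_smul_left, real_inner_smul_right, real_inner_smul_left, real_inner_smul_right,
            huu, htu, real_inner_comm u t, htu, htt]
          nlinarith [hs3sq, hσ]
        have h0 : 0 ≤ ‖(1 / 2 : ℝ) • u + (σ * (s3 / 2)) • t‖ := norm_nonneg _
        nlinarith [e, h0]
      have hdpn : ‖dp‖ = 1 := by
        have := hnorm 1 (by norm_num); rwa [one_mul, ← hdp] at this
      have hdmn : ‖dm‖ = 1 := by
        have := hnorm (-1) (by norm_num)
        rwa [neg_one_mul, neg_smul, ← sub_eq_add_neg, ← hdm] at this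
      have hcone : ∀ σ : ℝ, ⟪u, (1 / 2 : ℝ) • u + (σ * (s3 / 2)) • t⟫ = 1 / 2 := by
        intro σ
        rw [inner_add_right, real_inner_smul_right, real_inner_smul_right, huu, htu]
        ring
      have hTdp : ‖T dp‖ ≤ S := h dp hdpn (by
        have := hcone 1; rw [one_mul] at this; rw [hdp, this])
      have hTdm : ‖T dm‖ ≤ S := h dm hdmn (by
        have := hcone (-1); rw [neg_one_mul, neg_smul, ← sub_eq_add_neg] at this; rw [hdm, this])
      -- `t = (dp - dm)/√3` and `y = a u + ‖t'‖ t`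
      have htd : t = s3⁻¹ • (dp - dm) := by
        rw [hdp, hdm, show (1 / 2 : ℝ) • u + (s3 / 2) • t - ((1 / 2 : ℝ) • u - (s3 / 2) • t) =
          s3 • t by module, smul_smul, inv_mul_cancel₀ hs3pos.ne', one_smul]
      have hy' : y = a • u + ‖t'‖ • t := by
        rw [hydec, ht, smul_smul, mul_inv_cancel₀ htpos.ne', one_smul]
      rw [hy', map_add, map_smul, map_smul, htd, map_smul, map_sub]
      have hinv : s3⁻¹ ≤ 1 := by rwa [inv_le_one₀ hs3pos]
      calc ‖a • T u + ‖t'‖ • s3⁻¹ • (T dp - T dm)‖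
          ≤ ‖a • T u‖ + ‖‖t'‖ • s3⁻¹ • (T dp - T dm)‖ := norm_add_le _ _
        _ = |a| * ‖T u‖ + ‖t'‖ * (s3⁻¹ * ‖T dp - T dm‖) := by
            rw [norm_smul, norm_smul, norm_smul, Real.norm_eq_abs, Real.norm_eq_abs, abs_of_nonneg (norm_nonneg _),
              Real.norm_eq_abs, abs_of_pos (inv_pos.2 hs3pos)]
        _ ≤ 1 * S + 1 * (1 * (S + S)) := by
            refine add_le_add (mul_le_mul ha1 hTu (norm_nonneg _) zero_le_one)
              (mul_le_mul ht'1 (mul_le_mul hinv ((norm_sub_le _ _).trans (add_le_add hTdp hTdm))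
                (norm_nonneg _) zero_le_one) (by positivity) zero_le_one)
        _ = 3 * S := by ring
  refine ContinuousLinearMap.opNorm_le_bound _ (by positivity) fun y => ?_
  by_cases hy : y = 0
  · rw [hy, map_zero, norm_zero, norm_zero, mul_zero]
  · have hyn : 0 < ‖y‖ := norm_pos_iff.2 hy
    have hunit : ‖‖y‖⁻¹ • y‖ = 1 := by rw [norm_smul, norm_inv, norm_norm, inv_mul_cancel₀ hyn.ne']
    have := key _ hunit
    rw [map_smul, norm_smul, norm_inv, norm_norm] at this
    rwa [inv_mul_le_iff₀ hyn, mul_comm] at this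

/-! ### Inward segments stay in the cylinder -/

/-- The radial unit vector is a unit vector off the axis. [folklore] -/
theorem norm_eR_eq_one' {x : EuclideanSpace ℝ (Fin 3)} (hx : cylRadius x ≠ 0) : ‖eR x‖ = 1 := by
  have hr : 0 < cylRadius x := lt_of_le_of_ne (cylRadius_nonneg x) (Ne.symm hx)
  rw [eR_eq_smul_horizontalProj, norm_smul, norm_inv, Real.norm_eq_abs, abs_of_pos hr,
    norm_horizontalProj, inv_mul_cancel₀ hx]

/-- **Inward segments stay in the cylinder**: for `r(p) < 1`, a unit direction `d` which is
inward (`⟨−e_r(p), d⟩ ≥ 1/2`) or arbitrary when `r(p) ≤ 1/2`, and `0 ≤ s ≤ 1/4`, the point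
`p + s d` lies in the open cylinder (`r(p + sd)² ≤ r² − s r + s² ≤ r²` resp. `r + s < 1`).
[folklore] -/
theorem add_smul_mem_unitCylinder_of_cone {p d : EuclideanSpace ℝ (Fin 3)}
    (hp : p ∈ (unitCylinder : Set (EuclideanSpace ℝ (Fin 3)))) (hd : ‖d‖ = 1) {s : ℝ} (hs0 : 0 ≤ s)
    (hs : s ≤ 1 / 4) (hcone : cylRadius p ≤ 1 / 2 ∨ (1 : ℝ) / 2 ≤ ⟪-eR p, d⟫) :
    p + s • d ∈ (unitCylinder : Set (EuclideanSpace ℝ (Fin 3))) := by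
  rw [SetLike.mem_coe, mem_unitCylinder] at hp ⊢
  have hPd : ‖horizontalProj d‖ ≤ 1 := (norm_horizontalProj_le d).trans_eq hd
  -- the easy case `r(p) ≤ 1/2`
  by_cases hp2 : cylRadius p ≤ 1 / 2
  · rw [← norm_horizontalProj, map_add, map_smul]
    calc ‖horizontalProj p + s • horizontalProj d‖ ≤ ‖horizontalProj p‖ + ‖s • horizontalProj d‖ := norm_add_le _ _
      _ ≤ 1 / 2 + s * 1 := by
          rw [norm_horizontalProj, norm_smul, Real.norm_eq_abs, abs_of_nonneg hs0]
          exact add_le_add hp2 (mul_le_mul_of_nonneg_left hPd hs0)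
      _ < 1 := by linarith
  · rw [not_le] at hp2
    have hc : (1 : ℝ) / 2 ≤ ⟪-eR p, d⟫ := hcone.resolve_left (not_le.2 hp2)
    have hp0 : cylRadius p ≠ 0 := by linarith
    have hinner : ⟪horizontalProj p, d⟫ ≤ -(cylRadius p / 2) := by
      rw [inner_neg_left, eR_eq_smul_horizontalProj, real_inner_smul_left] at hc
      have e : ⟪horizontalProj p, d⟫ = cylRadius p * ((cylRadius p)⁻¹ * ⟪horizontalProj p, d⟫) := by
        field_simp
      rw [e]
      nlinarith
    have hsq : cylRadius (p + s • d) ^ 2 < 1 := by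
      rw [cylRadius_sq_eq_norm_sq, map_add, map_smul, norm_add_sq_real, norm_horizontalProj,
        real_inner_smul_right, inner_horizontalProj_horizontalProj, norm_smul, Real.norm_eq_abs,
        abs_of_nonneg hs0, mul_pow]
      have h1 : ‖horizontalProj d‖ ^ 2 ≤ 1 := by nlinarith [norm_nonneg (horizontalProj d)]
      have h2 : cylRadius p ^ 2 < 1 := by nlinarith [cylRadius_nonneg p]
      nlinarith
    have h0 : 0 ≤ cylRadius (p + s • d) := cylRadius_nonneg _
    nlinarith

/-! ### From difference quotients to the derivative (Morrey step) -/

/-- **Difference quotients to derivatives by the `C^{1,1/2}` bound**: if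
`‖Dv(x) − Dv(y)‖ ≤ C n |x − y|^{1/2}` on the open cylinder and the segment `[p, p + h]` lies in
it, then `‖Dv(p) h − (v(p + h) − v(p))‖ ≤ C n ‖h‖^{1/2} ‖h‖` (mean value inequality for
`y ↦ v(y) − Dv(p) y`). [folklore] -/
theorem norm_fderiv_sub_le_of_holderHalf {F : Type*} [NormedAddCommGroup F] [NormedSpace ℝ F]
    {v : EuclideanSpace ℝ (Fin 3) → F} {C n : ℝ} (hCn : 0 ≤ C * n)
    (hH : ∀ x ∈ (unitCylinder : Set (EuclideanSpace ℝ (Fin 3))),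
      ∀ y ∈ (unitCylinder : Set (EuclideanSpace ℝ (Fin 3))),
        ‖fderiv ℝ v x - fderiv ℝ v y‖ ≤ C * n * ‖x - y‖ ^ (1 / 2 : ℝ))
    (hvd : ∀ x ∈ (unitCylinder : Set (EuclideanSpace ℝ (Fin 3))), DifferentiableAt ℝ v x)
    {p h : EuclideanSpace ℝ (Fin 3)}
    (hseg : ∀ s ∈ Icc (0 : ℝ) 1, p + s • h ∈ (unitCylinder : Set (EuclideanSpace ℝ (Fin 3)))) :
    ‖fderiv ℝ v p h - (v (p + h) - v p)‖ ≤ C * n * ‖h‖ ^ (1 / 2 : ℝ) * ‖h‖ := by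
  set g : EuclideanSpace ℝ (Fin 3) → F := fun y => v y - fderiv ℝ v p y with hg
  have hmem : ∀ y ∈ segment ℝ p (p + h), ∃ s ∈ Icc (0 : ℝ) 1, y = p + s • h := by
    intro y hy
    rw [segment_eq_image'] at hy
    obtain ⟨s, hs, rfl⟩ := hy
    exact ⟨s, hs, by simp⟩
  have hdiff : ∀ y ∈ segment ℝ p (p + h), DifferentiableAt ℝ g y := by
    intro y hy
    obtain ⟨s, hs, rfl⟩ := hmem y hy
    exact (hvd _ (hseg s hs)).sub ((fderiv ℝ v p).differentiableAt)
  have hbound : ∀ y ∈ segment ℝ p (p + h), ‖fderiv ℝ g y‖ ≤ C * n * ‖h‖ ^ (1 / 2 : ℝ) := by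
    intro y hy
    obtain ⟨s, hs, rfl⟩ := hmem y hy
    have hy' := hseg s hs
    have hp' : p ∈ (unitCylinder : Set (EuclideanSpace ℝ (Fin 3))) := by
      have := hseg 0 (left_mem_Icc.2 zero_le_one); simpa using this
    rw [hg, fderiv_fun_sub (hvd _ hy') (fderiv ℝ v p).differentiableAt, ContinuousLinearMap.fderiv]
    refine (hH _ hy' p hp').trans ?_
    have hsh : ‖p + s • h - p‖ ≤ ‖h‖ := by
      rw [add_sub_cancel_left, norm_smul, Real.norm_eq_abs, abs_of_nonneg hs.1]
      exact mul_le_of_le_one_left (norm_nonneg _) hs.2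
    exact mul_le_mul_of_nonneg_left (Real.rpow_le_rpow (norm_nonneg _) hsh (by norm_num)) hCn
  have hmv := (convex_segment p (p + h)).norm_image_sub_le_of_norm_fderiv_le hdiff hbound
    (left_mem_segment ℝ p (p + h)) (right_mem_segment ℝ p (p + h))
  have e : g (p + h) - g p = -(fderiv ℝ v p h - (v (p + h) - v p)) := by
    simp only [hg, map_add]; abel
  rw [e, norm_neg, add_sub_cancel_left] at hmv
  exact hmv

/-! ### Bounds on the closed cylinder from bounds on the open one -/

/-- A bound for a function continuous on the closed cylinder, valid on the open cylinder, holds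
on the closed cylinder. [folklore] -/
theorem norm_le_of_closure {F : Type*} [NormedAddCommGroup F]
    {v : EuclideanSpace ℝ (Fin 3) → F}
    (hvc : ContinuousOn v (closure (unitCylinder : Set (EuclideanSpace ℝ (Fin 3))))) {V : ℝ}
    (hV : ∀ p ∈ (unitCylinder : Set (EuclideanSpace ℝ (Fin 3))), ‖v p‖ ≤ V) {p : EuclideanSpace ℝ (Fin 3)}
    (hp : p ∈ closure (unitCylinder : Set (EuclideanSpace ℝ (Fin 3)))) : ‖v p‖ ≤ V := by
  have hcont : ContinuousWithinAt (fun q => ‖v q‖) (unitCylinder : Set (EuclideanSpace ℝ (Fin 3))) p :=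
    ((hvc p hp).mono subset_closure).norm
  haveI : (𝓝[(unitCylinder : Set (EuclideanSpace ℝ (Fin 3)))] p).NeBot :=
    mem_closure_iff_nhdsWithin_neBot.1 hp
  exact le_of_tendsto hcont (eventually_nhdsWithin_of_forall fun q hq => hV q hq)

/-! ### The sup of `|v|` by the energy and a small multiple of `sup ‖Dv‖` -/

/-- **A ball of radius `R₂/2` inside the cylinder next to any interior point**: for `r(p) < 1` and
`0 < R₂ ≤ 1/2` there is `c` with `‖p − c‖ ≤ R₂/2` and `B(c, R₂/2) ⊆ {r < 1}` (`c = p` near the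
axis, `c = p − (R₂/2) e_r(p)` otherwise). [folklore] -/
theorem exists_ball_subset_unitCylinder {p : EuclideanSpace ℝ (Fin 3)}
    (hp : p ∈ (unitCylinder : Set (EuclideanSpace ℝ (Fin 3)))) {R₂ : ℝ} (hR₂ : 0 < R₂) (hR₂1 : R₂ ≤ 1 / 2) :
    ∃ c : EuclideanSpace ℝ (Fin 3), ‖p - c‖ ≤ R₂ / 2 ∧
      ball c (R₂ / 2) ⊆ (unitCylinder : Set (EuclideanSpace ℝ (Fin 3))) := by
  rw [SetLike.mem_coe, mem_unitCylinder] at hp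
  by_cases hp2 : cylRadius p ≤ 1 / 2
  · refine ⟨p, by rw [sub_self, norm_zero]; positivity, fun q hq => ?_⟩
    rw [SetLike.mem_coe, mem_unitCylinder]
    rw [mem_ball, dist_eq_norm] at hq
    have := cylRadius_sub_le_norm_sub q p
    linarith
  · rw [not_le] at hp2
    have hp0 : cylRadius p ≠ 0 := by linarith
    refine ⟨p - (R₂ / 2) • eR p, ?_, fun q hq => ?_⟩
    · rw [sub_sub_cancel, norm_smul, Real.norm_eq_abs, abs_of_pos (by positivity), norm_eR_eq_one' hp0, mul_one]
    · rw [SetLike.mem_coe, mem_unitCylinder]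
      rw [mem_ball, dist_eq_norm] at hq
      -- `r(c) = r(p) - R₂/2`
      have hc : cylRadius (p - (R₂ / 2) • eR p) = cylRadius p - R₂ / 2 := by
        have e : horizontalProj (p - (R₂ / 2) • eR p) = (1 - R₂ / 2 * (cylRadius p)⁻¹) • horizontalProj p := by
          rw [map_sub, map_smul, eR_eq_smul_horizontalProj, map_smul, horizontalProj_horizontalProj, smul_smul,
            sub_smul, one_smul]
        have hcoef : 0 ≤ 1 - R₂ / 2 * (cylRadius p)⁻¹ := by
          rw [sub_nonneg, ← div_eq_mul_inv, div_le_one (by linarith)]; linarith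
        rw [← norm_horizontalProj, e, norm_smul, Real.norm_eq_abs, abs_of_nonneg hcoef, norm_horizontalProj]
        field_simp
      have := cylRadius_sub_le_norm_sub q (p - (R₂ / 2) • eR p)
      linarith

/-- **The sup of `|v|` by the energy and a small multiple of the gradient bound**: for `v`
continuous on the closed cylinder, differentiable in the open one with `‖Dv‖ ≤ G`, `L`-periodic
with `‖v‖_{L²(cell)} ≤ e`, and `0 < R₂ ≤ 1/2`, every interior value obeys
`‖v(p)‖ ≤ |B(0, R₂/2)|^{-1/2} (⌈R₂/L⌉ + 1)^{1/2} e + R₂ G` (mean value inequality over the ball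
of `exists_ball_subset_unitCylinder`, `L¹ ≤ |B|^{1/2} L²` on it, and the ball carries at most
`⌈R₂/L⌉ + 1` cells of energy, `lintegral_ball_le_mul_lintegral_cylinderCell`). [folklore] -/
theorem norm_le_of_ball_average {L : ℝ} (hL : 0 < L) {v : EuclideanSpace ℝ (Fin 3) → EuclideanSpace ℝ (Fin 3)}
    (hvc : ContinuousOn v (closure (unitCylinder : Set (EuclideanSpace ℝ (Fin 3)))))
    (hvd : ∀ x ∈ (unitCylinder : Set (EuclideanSpace ℝ (Fin 3))), DifferentiableAt ℝ v x)
    (hper : IsAxiallyPeriodic L v) {G : ℝ}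
    (hG : ∀ x ∈ (unitCylinder : Set (EuclideanSpace ℝ (Fin 3))), ‖fderiv ℝ v x‖ ≤ G) {e : ℝ≥0}
    (he : eLpNorm v 2 (volume.restrict (cylinderCell L : Set (EuclideanSpace ℝ (Fin 3)))) ≤ e)
    {R₂ : ℝ} (hR₂ : 0 < R₂) (hR₂1 : R₂ ≤ 1 / 2) {p : EuclideanSpace ℝ (Fin 3)}
    (hp : p ∈ (unitCylinder : Set (EuclideanSpace ℝ (Fin 3)))) :
    ‖v p‖ ≤ ((volume (ball (0 : EuclideanSpace ℝ (Fin 3)) (R₂ / 2))).toReal ^ (1 / 2 : ℝ))⁻¹ *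
        ((((⌈2 * (R₂ / 2) / L⌉₊ + 1 : ℕ) : ℝ) ^ (1 / 2 : ℝ)) * e) + R₂ * G := by
  have hG0 : 0 ≤ G := (norm_nonneg _).trans (hG p hp)
  obtain ⟨c, hpc, hball⟩ := exists_ball_subset_unitCylinder hp hR₂ hR₂1
  set Ω : Set (EuclideanSpace ℝ (Fin 3)) := ball c (R₂ / 2) with hΩ_def
  have hΩmeas : MeasurableSet Ω := measurableSet_ball
  have hΩvol : volume Ω = volume (ball (0 : EuclideanSpace ℝ (Fin 3)) (R₂ / 2)) :=
    Measure.addHaar_ball_center volume c (R₂ / 2)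
  have hΩfin : volume Ω < ⊤ := measure_ball_lt_top
  have hΩpos : 0 < volume Ω := measure_ball_pos volume c (by positivity)
  set V : ℝ := (volume Ω).toReal with hV
  have hVpos : 0 < V := ENNReal.toReal_pos hΩpos.ne' hΩfin.ne
  -- the mean value inequality
  have hmv : ∀ q ∈ Ω, ‖v p‖ ≤ ‖v q‖ + G * R₂ := by
    intro q hq
    have hqU := hball hq
    have h1 : ‖v p - v q‖ ≤ G * ‖p - q‖ :=
      convex_unitCylinder.norm_image_sub_le_of_norm_fderiv_le hvd hG hqU hp
    have h2 : ‖p - q‖ ≤ R₂ := by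
      rw [hΩ_def, mem_ball, dist_eq_norm] at hq
      calc ‖p - q‖ ≤ ‖p - c‖ + ‖c - q‖ := norm_sub_le_norm_sub_add_norm_sub _ _ _
        _ ≤ R₂ / 2 + R₂ / 2 := add_le_add hpc (by rw [norm_sub_rev]; exact hq.le)
        _ = R₂ := by ring
    calc ‖v p‖ = ‖v q + (v p - v q)‖ := by rw [add_sub_cancel]
      _ ≤ ‖v q‖ + ‖v p - v q‖ := norm_add_le _ _
      _ ≤ ‖v q‖ + G * R₂ := by gcongr; exact h1.trans (by gcongr)
  -- continuity and integrability on the ball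
  have hΩcl : closure Ω = closedBall c (R₂ / 2) := closure_ball c (by positivity)
  have hΩK : closure Ω ⊆ closure (unitCylinder : Set (EuclideanSpace ℝ (Fin 3))) := closure_mono hball
  have hvc' : ContinuousOn v (closure Ω) := hvc.mono hΩK
  have hint : IntegrableOn (fun y => ‖v y‖) Ω volume := by
    have hK : IsCompact (closure Ω) := by rw [hΩcl]; exact isCompact_closedBall c (R₂ / 2)
    have h := hvc'.norm.integrableOn_compact (μ := (volume : Measure (EuclideanSpace ℝ (Fin 3)))) hK
    exact h.mono_set subset_closure
  have hmeasv : AEStronglyMeasurable v (volume.restrict Ω) :=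
    (hvc'.mono subset_closure).aestronglyMeasurable hΩmeas
  -- the energy on the ball: at most `N` cells
  set N : ℕ := ⌈2 * (R₂ / 2) / L⌉₊ + 1 with hN
  have hlin : ∫⁻ y in Ω, ‖v y‖ₑ ^ (2 : ℝ) ≤
      (N : ℝ≥0∞) * ∫⁻ y in (cylinderCell L : Set (EuclideanSpace ℝ (Fin 3))), ‖v y‖ₑ ^ (2 : ℝ) := by
    have h := lintegral_ball_le_mul_lintegral_cylinderCell hL (G := fun y => ‖v y‖ₑ ^ (2 : ℝ))
      (fun y => by show ‖v (y + _)‖ₑ ^ (2 : ℝ) = ‖v y‖ₑ ^ (2 : ℝ); rw [hper y]) hball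
    simpa [hN] using h
  set e' : ℝ≥0 := (N : ℝ≥0) ^ (1 / 2 : ℝ) * e with he'_def
  have he' : eLpNorm v 2 (volume.restrict Ω) ≤ e' := by
    have h2 := he
    rw [eLpNorm_eq_lintegral_rpow_enorm_toReal two_ne_zero ENNReal.ofNat_ne_top] at h2 ⊢
    simp only [ENNReal.toReal_ofNat] at h2 ⊢
    rw [he'_def, ENNReal.coe_mul, ENNReal.coe_rpow_of_nonneg _ (by norm_num : (0 : ℝ) ≤ 1 / 2), ENNReal.coe_natCast]
    calc (∫⁻ y in Ω, ‖v y‖ₑ ^ (2 : ℝ)) ^ (1 / (2 : ℝ))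
        ≤ ((N : ℝ≥0∞) * ∫⁻ y in (cylinderCell L : Set (EuclideanSpace ℝ (Fin 3))), ‖v y‖ₑ ^ (2 : ℝ)) ^ (1 / (2 : ℝ)) :=
          ENNReal.rpow_le_rpow hlin (by norm_num)
      _ = (N : ℝ≥0∞) ^ (1 / (2 : ℝ)) *
            (∫⁻ y in (cylinderCell L : Set (EuclideanSpace ℝ (Fin 3))), ‖v y‖ₑ ^ (2 : ℝ)) ^ (1 / (2 : ℝ)) :=
          ENNReal.mul_rpow_of_nonneg _ _ (by norm_num)
      _ ≤ (N : ℝ≥0∞) ^ (1 / 2 : ℝ) * (e : ℝ≥0∞) := by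
          rw [one_div]
          gcongr
          rw [← one_div]
          exact h2
  -- `L¹ ≤ |Ω|^{1/2} L²`
  have hL1 : ∫ y in Ω, ‖v y‖ ≤ V ^ (1 / 2 : ℝ) * e' := by
    have h1 : eLpNorm v 1 (volume.restrict Ω) ≤
        eLpNorm v 2 (volume.restrict Ω) * (volume.restrict Ω) univ ^ (1 / (1 : ℝ≥0∞).toReal - 1 / (2 : ℝ≥0∞).toReal) :=
      eLpNorm_le_eLpNorm_mul_rpow_measure_univ (by norm_num) hmeasv
    rw [Measure.restrict_apply_univ] at h1
    have hexp : (1 / (1 : ℝ≥0∞).toReal - 1 / (2 : ℝ≥0∞).toReal : ℝ) = 1 / 2 := by norm_num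
    rw [hexp] at h1
    have h2 : eLpNorm v 1 (volume.restrict Ω) ≤ (e' : ℝ≥0∞) * volume Ω ^ (1 / 2 : ℝ) :=
      h1.trans (by gcongr)
    have h3 : ∫ y in Ω, ‖v y‖ = (eLpNorm v 1 (volume.restrict Ω)).toReal := by
      rw [eLpNorm_one_eq_lintegral_enorm, integral_norm_eq_lintegral_enorm hmeasv]
    rw [h3]
    have hfin : (e' : ℝ≥0∞) * volume Ω ^ (1 / 2 : ℝ) ≠ ⊤ :=
      ENNReal.mul_ne_top ENNReal.coe_ne_top (ENNReal.rpow_ne_top_of_nonneg (by norm_num) hΩfin.ne)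
    have h4 := ENNReal.toReal_mono hfin h2
    rw [ENNReal.toReal_mul, ENNReal.coe_toReal, ← ENNReal.toReal_rpow] at h4
    linarith [h4, mul_comm (e' : ℝ) (V ^ (1 / 2 : ℝ))]
  -- average the mean value inequality over the ball
  have hconst : ∫ _ in Ω, ‖v p‖ = V * ‖v p‖ := by
    rw [setIntegral_const, smul_eq_mul, Measure.real, hV]
  have hle : ∫ _ in Ω, ‖v p‖ ≤ ∫ y in Ω, (‖v y‖ + G * R₂) := by
    refine setIntegral_mono_on (integrableOn_const hΩfin.ne) (hint.add (integrableOn_const hΩfin.ne))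
      hΩmeas fun y hy => hmv y hy
  rw [hconst, integral_add hint (integrableOn_const hΩfin.ne), setIntegral_const, smul_eq_mul,
    Measure.real] at hle
  have hle' : V * ‖v p‖ ≤ V ^ (1 / 2 : ℝ) * e' + V * (G * R₂) := by rw [hV]; linarith
  have hVhalf : V = V ^ (1 / 2 : ℝ) * V ^ (1 / 2 : ℝ) := by
    rw [← Real.rpow_add hVpos]; norm_num
  have hVhpos : 0 < V ^ (1 / 2 : ℝ) := Real.rpow_pos_of_pos hVpos _
  have key : ‖v p‖ ≤ (V ^ (1 / 2 : ℝ))⁻¹ * e' + G * R₂ := by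
    rw [hVhalf] at hle'
    have h5 : V ^ (1 / 2 : ℝ) * ‖v p‖ ≤ e' + V ^ (1 / 2 : ℝ) * (G * R₂) := by
      nlinarith [hVhpos]
    calc ‖v p‖ = (V ^ (1 / 2 : ℝ))⁻¹ * (V ^ (1 / 2 : ℝ) * ‖v p‖) := by field_simp
      _ ≤ (V ^ (1 / 2 : ℝ))⁻¹ * (e' + V ^ (1 / 2 : ℝ) * (G * R₂)) := by gcongr
      _ = (V ^ (1 / 2 : ℝ))⁻¹ * e' + G * R₂ := by field_simp
  have he'r : (e' : ℝ) = ((N : ℝ) ^ (1 / 2 : ℝ)) * e := by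
    rw [he'_def, NNReal.coe_mul, NNReal.coe_rpow, NNReal.coe_natCast]
  rw [hV, hΩvol] at key
  rw [← he'r, mul_comm R₂ G]
  exact key

/-! ### The discharge -/

/-- Elementary: `log(R/δ) ≤ log 4 + 2 log⁺ n` and `n δ^{1/2} ≤ 1` for
`δ = min(R/4, max(1,n)⁻²)`, `0 < R ≤ 1`. [folklore] -/
theorem delta_facts {R : ℝ} (hR : 0 < R) (hR1 : R ≤ 1) (n : ℝ≥0) :
    0 < min (R / 4) ((max 1 (n : ℝ))⁻¹ ^ 2) ∧
    4 * min (R / 4) ((max 1 (n : ℝ))⁻¹ ^ 2) ≤ R ∧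
    (n : ℝ) * (min (R / 4) ((max 1 (n : ℝ))⁻¹ ^ 2)) ^ (1 / 2 : ℝ) ≤ 1 ∧
    0 ≤ Real.log (R / min (R / 4) ((max 1 (n : ℝ))⁻¹ ^ 2)) ∧
    Real.log (R / min (R / 4) ((max 1 (n : ℝ))⁻¹ ^ 2)) ≤ Real.log 4 + 2 * Real.posLog n := by
  set m : ℝ := max 1 (n : ℝ) with hm
  have hm1 : 1 ≤ m := le_max_left _ _
  have hm0 : 0 < m := by linarith
  have hnm : (n : ℝ) ≤ m := le_max_right _ _
  set δ : ℝ := min (R / 4) (m⁻¹ ^ 2) with hδ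
  have hδ0 : 0 < δ := lt_min (by positivity) (by positivity)
  have hδR : 4 * δ ≤ R := by have := min_le_left (R / 4) (m⁻¹ ^ 2); linarith
  have hδm : δ ≤ m⁻¹ ^ 2 := min_le_right _ _
  refine ⟨hδ0, hδR, ?_, ?_, ?_⟩
  · -- `n δ^{1/2} ≤ n / m ≤ 1`
    have h1 : δ ^ (1 / 2 : ℝ) ≤ m⁻¹ := by
      calc δ ^ (1 / 2 : ℝ) ≤ (m⁻¹ ^ 2) ^ (1 / 2 : ℝ) := Real.rpow_le_rpow hδ0.le hδm (by norm_num)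
        _ = m⁻¹ := by
            rw [show (m⁻¹ ^ 2 : ℝ) = m⁻¹ ^ (2 : ℝ) by norm_cast, ← Real.rpow_mul (by positivity)]
            norm_num
    calc (n : ℝ) * δ ^ (1 / 2 : ℝ) ≤ m * m⁻¹ :=
          mul_le_mul hnm h1 (Real.rpow_nonneg hδ0.le _) hm0.le
      _ = 1 := mul_inv_cancel₀ hm0.ne'
  · refine Real.log_nonneg ?_
    rw [le_div_iff₀ hδ0]; linarith
  · have hRδ : R / δ ≤ 4 * m ^ 2 := by
      rw [div_le_iff₀ hδ0]
      rcases min_choice (R / 4) (m⁻¹ ^ 2) with h | h <;> rw [hδ, h]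
      · have hm2 : 1 ≤ m ^ 2 := by nlinarith
        nlinarith [mul_le_mul_of_nonneg_left hm2 hR.le]
      · have : m ^ 2 * m⁻¹ ^ 2 = 1 := by field_simp
        nlinarith
    calc Real.log (R / δ) ≤ Real.log (4 * m ^ 2) := Real.log_le_log (by positivity) hRδ
      _ = Real.log 4 + 2 * Real.log m := by
          rw [Real.log_mul (by norm_num) (by positivity), Real.log_pow]; ring
      _ = Real.log 4 + 2 * Real.posLog n := by rw [Real.posLog_eq_log_max_one n.coe_nonneg]

/-- **Discharge of the stationary logarithmic div–curl estimate in the periodic cylinder**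
(Shirota–Yanagisawa 1993, (15) p. 80 for one field with its own `L²` norm; Ferrari 1993, Cor. 1
(31) p. 286): proved by reflection across the wall, the regularised Biot–Savart identity, the
log-Lipschitz kernel bounds and the `C^{1,1/2}` Morrey bound — see the module docstring.
[cite: ShirotaYanagisawa1993, (15) p. 80] -/
theorem ShirotaYanagisawa1993_periodicCylinderLogDivCurlEstimate_holds :
    ShirotaYanagisawa1993_periodicCylinderLogDivCurlEstimate := by
  intro L hL
  -- constants independent of `v`
  obtain ⟨CM, hCM⟩ := periodicCylinder_fderiv_holderHalf_norm_le (F := EuclideanSpace ℝ (Fin 3)) hL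
  obtain ⟨C₀, hC₀0, hC₀⟩ := exists_norm_fderiv_ballCutoff_le
  obtain ⟨K, hK⟩ : ∃ K : ℝ, K =
      3 * (3 * (5 * (4 * π)⁻¹ + 8 / π) * (3 * (volume : Measure (EuclideanSpace ℝ (Fin 3))).real (ball 0 1)) +
          (2 * (4 * π)⁻¹ + 8 / π) * (3 * (volume : Measure (EuclideanSpace ℝ (Fin 3))).real (ball 0 1)) +
          32 * (8 / π)) / ∫ u, regDelta (1 : ℝ) u := ⟨_, rfl⟩
  have hK0 : 0 ≤ K := by
    rw [hK]
    have := three_mul_volume_real_ball_nonneg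
    have := integral_regDelta_one_pos
    positivity
  obtain ⟨vB, hvB⟩ : ∃ vB : ℝ, vB = (volume : Measure (EuclideanSpace ℝ (Fin 3))).real (closedBall 0 1) := ⟨_, rfl⟩
  have hvB0 : 0 ≤ vB := by rw [hvB]; exact measureReal_nonneg
  -- the radii
  obtain ⟨R, hRdef⟩ : ∃ R : ℝ, R = min (1 / 4) (1 / (360 * K + 1)) := ⟨_, rfl⟩
  have hR0 : 0 < R := by rw [hRdef]; exact lt_min (by norm_num) (by positivity)
  have hR4 : R ≤ 1 / 4 := by rw [hRdef]; exact min_le_left _ _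
  have hRK : 90 * K * R ≤ 1 / 4 := by
    have h1 : R ≤ 1 / (360 * K + 1) := by rw [hRdef]; exact min_le_right _ _
    have h2 : 90 * K * (1 / (360 * K + 1)) ≤ 1 / 4 := by
      rw [mul_one_div, div_le_iff₀ (by positivity)]; nlinarith
    exact (mul_le_mul_of_nonneg_left h1 (by positivity)).trans h2
  obtain ⟨R₂, hR₂def⟩ : ∃ R₂ : ℝ, R₂ = min (1 / 2) (R ^ 4 / (432 * K * C₀ * vB + 1)) := ⟨_, rfl⟩
  have hR₂0 : 0 < R₂ := by rw [hR₂def]; exact lt_min (by norm_num) (by positivity)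
  have hR₂1 : R₂ ≤ 1 / 2 := by rw [hR₂def]; exact min_le_left _ _
  have hR₂K : 108 * K * C₀ * vB * R₂ / R ^ 4 ≤ 1 / 4 := by
    have h1 : R₂ ≤ R ^ 4 / (432 * K * C₀ * vB + 1) := by rw [hR₂def]; exact min_le_right _ _
    have hR4pos : 0 < R ^ 4 := by positivity
    rw [div_le_iff₀ hR4pos]
    have h2 : 108 * K * C₀ * vB * (R ^ 4 / (432 * K * C₀ * vB + 1)) ≤ 1 / 4 * R ^ 4 := by
      rw [mul_div_assoc', div_le_iff₀ (by positivity)]; nlinarith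
    exact (mul_le_mul_of_nonneg_left h1 (by positivity)).trans h2
  obtain ⟨Ce, hCe⟩ : ∃ Ce : ℝ, Ce = ((volume (ball (0 : EuclideanSpace ℝ (Fin 3)) (R₂ / 2))).toReal ^ (1 / 2 : ℝ))⁻¹ *
      (((⌈2 * (R₂ / 2) / L⌉₊ + 1 : ℕ) : ℝ) ^ (1 / 2 : ℝ)) := ⟨_, rfl⟩
  have hCe0 : 0 ≤ Ce := by rw [hCe]; positivity
  have hlog4 : 0 ≤ Real.log 4 := Real.log_nonneg (by norm_num)
  -- the constant
  obtain ⟨Cfin, hCfin⟩ : ∃ Cfin : ℝ, Cfin = 6 * CM + 1152 * K * (1 + Real.log 4) + 216 * K * C₀ * vB * Ce / R ^ 4 :=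
    ⟨_, rfl⟩
  have hCfin0 : 0 ≤ Cfin := by rw [hCfin]; positivity
  refine ⟨Real.toNNReal Cfin, ?_⟩
  intro v hv hper hdiv hslip n e A hn he hA x hx
  rw [Real.coe_toNNReal Cfin hCfin0]
  -- the Morrey bound for this `v`, the sup of `‖Dv‖`
  obtain ⟨hH, hbd⟩ := hCM v hv hper n hn
  have hbdd : BddAbove ((fun p => ‖fderiv ℝ v p‖) '' (unitCylinder : Set (EuclideanSpace ℝ (Fin 3)))) :=
    ⟨CM * n, by rintro _ ⟨p, hp, rfl⟩; exact hbd p hp⟩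
  have hne : ((fun p => ‖fderiv ℝ v p‖) '' (unitCylinder : Set (EuclideanSpace ℝ (Fin 3)))).Nonempty :=
    ⟨_, ⟨0, zero_mem_unitCylinder, rfl⟩⟩
  obtain ⟨G, hGdef⟩ : ∃ G : ℝ, G = sSup ((fun p => ‖fderiv ℝ v p‖) '' (unitCylinder : Set (EuclideanSpace ℝ (Fin 3)))) :=
    ⟨_, rfl⟩
  have hG : ∀ p ∈ (unitCylinder : Set (EuclideanSpace ℝ (Fin 3))), ‖fderiv ℝ v p‖ ≤ G := fun p hp => by
    rw [hGdef]; exact le_csSup hbdd ⟨p, hp, rfl⟩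
  have hG0 : 0 ≤ G := (norm_nonneg _).trans (hG 0 zero_mem_unitCylinder)
  -- differentiability, continuity
  have hv1 : ContDiffOn ℝ 1 v (closure (unitCylinder : Set (EuclideanSpace ℝ (Fin 3)))) :=
    hv.of_le (by exact_mod_cast le_top)
  have hvd : ∀ p ∈ (unitCylinder : Set (EuclideanSpace ℝ (Fin 3))), DifferentiableAt ℝ v p := fun p hp =>
    (hv1.differentiableOn one_ne_zero p (subset_closure hp)).differentiableAt (closure_unitCylinder_mem_nhds hp)
  -- the sup of `|v|`
  have hVcyl : ∀ p ∈ (unitCylinder : Set (EuclideanSpace ℝ (Fin 3))), ‖v p‖ ≤ Ce * e + R₂ * G := by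
    intro p hp
    have h := norm_le_of_ball_average hL hv.continuousOn hvd hper hG he hR₂0 hR₂1 hp
    rw [hCe, mul_assoc]
    exact h
  have hV : ∀ p ∈ closure (unitCylinder : Set (EuclideanSpace ℝ (Fin 3))), ‖v p‖ ≤ Ce * e + R₂ * G := fun p hp =>
    norm_le_of_closure hv.continuousOn hVcyl hp
  have hVV0 : 0 ≤ Ce * e + R₂ * G := by positivity
  -- the radius `δ`
  obtain ⟨hδ0, hδR, hnδ, hlog0, hlogδ⟩ := delta_facts hR0 (by linarith) n
  set δ : ℝ := min (R / 4) ((max 1 (n : ℝ))⁻¹ ^ 2) with hδ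
  clear_value δ
  have hδ4 : δ ≤ 1 / 4 := by linarith
  have hA' : ∀ p ∈ (unitCylinder : Set (EuclideanSpace ℝ (Fin 3))), ‖curl v p‖ ≤ (A : ℝ) := hA
  -- the bound `S` of `‖Dv p d‖` along inward directions
  obtain ⟨S, hS⟩ : ∃ S : ℝ, S = CM * n * δ ^ (1 / 2 : ℝ) +
      K * (96 * A * (1 + Real.log (R / δ)) + 30 * G * R + 36 * C₀ * (Ce * e + R₂ * G) / R * vB / R ^ 3) := ⟨_, rfl⟩
  have hS0 : 0 ≤ S := by
    rw [hS]
    have : 0 ≤ 1 + Real.log (R / δ) := by linarith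
    positivity
  have main : ∀ p ∈ (unitCylinder : Set (EuclideanSpace ℝ (Fin 3))), ‖fderiv ℝ v p‖ ≤ 3 * S := by
    intro p hp
    have hp' : cylRadius p < 1 := hp
    -- the axis of the cone of inward directions
    obtain ⟨u, hu, hucone⟩ : ∃ u : EuclideanSpace ℝ (Fin 3), ‖u‖ = 1 ∧ ∀ d : EuclideanSpace ℝ (Fin 3),
        (1 : ℝ) / 2 ≤ ⟪u, d⟫ → (cylRadius p ≤ 1 / 2 ∨ (1 : ℝ) / 2 ≤ ⟪-eR p, d⟫) := by
      by_cases hp2 : cylRadius p ≤ 1 / 2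
      · exact ⟨EuclideanSpace.single 2 1, by simp, fun d _ => Or.inl hp2⟩
      · refine ⟨-eR p, ?_, fun d hd => Or.inr hd⟩
        rw [norm_neg, norm_eR_eq_one' (by rw [not_le] at hp2; linarith)]
    refine opNorm_le_three_mul_of_cone (fderiv ℝ v p) hu hS0 fun d hd hud => ?_
    have hcone := hucone d hud
    -- the segment `[p, p + δ d]`
    have hseg : ∀ s ∈ Icc (0 : ℝ) 1, p + s • (δ • d) ∈ (unitCylinder : Set (EuclideanSpace ℝ (Fin 3))) := by
      intro s hs
      rw [smul_smul]
      exact add_smul_mem_unitCylinder_of_cone hp hd (mul_nonneg hs.1 hδ0.le)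
        ((mul_le_of_le_one_left hδ0.le hs.2).trans hδ4) hcone
    have hz : p + δ • d ∈ (unitCylinder : Set (EuclideanSpace ℝ (Fin 3))) := by
      have := hseg 1 ⟨zero_le_one, le_rfl⟩; rwa [one_smul] at this
    have hz' : cylRadius (p + δ • d) < 1 := hz
    have hdn : ‖δ • d‖ = δ := by rw [norm_smul, Real.norm_eq_abs, abs_of_pos hδ0, hd, mul_one]
    have hpz : ‖p - (p + δ • d)‖ = δ := by rw [sub_add_cancel_left, norm_neg, hdn]
    have hxz : p ≠ p + δ • d := by
      intro h
      have : ‖p - (p + δ • d)‖ = 0 := by rw [← h, sub_self, norm_zero]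
      rw [hpz] at this
      exact hδ0.ne' this
    have hdist : 4 * ‖p - (p + δ • d)‖ ≤ R := by rw [hpz]; exact hδR
    -- the log-Lipschitz bound up to the wall
    have h1 := norm_sub_le_of_glued_reflection hv1 hdiv hslip hA' hG hV hC₀0 hC₀ hp' hR0 hR4 hz' hxz hdist
    rw [hpz, ← hK, ← hvB] at h1
    -- the Morrey step
    have h2 := norm_fderiv_sub_le_of_holderHalf (C := CM) (n := n) (by positivity) hH hvd hseg
    rw [hdn] at h2
    -- combine
    have h3 : ‖fderiv ℝ v p (δ • d)‖ ≤ CM * n * δ ^ (1 / 2 : ℝ) * δ + ‖v p - v (p + δ • d)‖ := by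
      calc ‖fderiv ℝ v p (δ • d)‖ ≤ ‖fderiv ℝ v p (δ • d) - (v (p + δ • d) - v p)‖ + ‖v (p + δ • d) - v p‖ :=
            norm_le_norm_sub_add _ _
        _ ≤ CM * n * δ ^ (1 / 2 : ℝ) * δ + ‖v p - v (p + δ • d)‖ := add_le_add h2 (by rw [norm_sub_rev])
    rw [map_smul, norm_smul, Real.norm_eq_abs, abs_of_pos hδ0] at h3
    have h4 : δ * ‖fderiv ℝ v p d‖ ≤ δ * S := by
      rw [hS]
      have e1 : δ * (CM * n * δ ^ (1 / 2 : ℝ) +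
          K * (96 * A * (1 + Real.log (R / δ)) + 30 * G * R + 36 * C₀ * (Ce * e + R₂ * G) / R * vB / R ^ 3)) =
          CM * n * δ ^ (1 / 2 : ℝ) * δ +
          K * (96 * A * δ * (1 + Real.log (R / δ)) + 30 * G * δ * R +
            36 * C₀ * (Ce * e + R₂ * G) / R * vB * δ / R ^ 3) := by ring
      rw [e1]
      exact h3.trans (add_le_add le_rfl h1)
    exact le_of_mul_le_mul_left h4 hδ0
  -- absorption
  have hGle : G ≤ 3 * S := by
    rw [hGdef]
    refine csSup_le hne ?_
    rintro _ ⟨p, hp, rfl⟩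
    exact main p hp
  have hGabs : G ≤ 6 * (CM * n * δ ^ (1 / 2 : ℝ)) + 576 * K * A * (1 + Real.log (R / δ)) +
      216 * K * C₀ * vB * Ce * e / R ^ 4 := by
    rw [hS] at hGle
    have hRpos : 0 < R ^ 4 := by positivity
    have t1 : 3 * (K * (30 * G * R)) ≤ G / 4 := by
      calc 3 * (K * (30 * G * R)) = G * (90 * K * R) := by ring
        _ ≤ G * (1 / 4) := mul_le_mul_of_nonneg_left hRK hG0
        _ = G / 4 := by ring
    have t2 : 3 * (K * (36 * C₀ * (R₂ * G) / R * vB / R ^ 3)) ≤ G / 4 := by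
      have e2 : 3 * (K * (36 * C₀ * (R₂ * G) / R * vB / R ^ 3)) = G * (108 * K * C₀ * vB * R₂ / R ^ 4) := by
        field_simp
        ring
      calc 3 * (K * (36 * C₀ * (R₂ * G) / R * vB / R ^ 3)) = G * (108 * K * C₀ * vB * R₂ / R ^ 4) := e2
        _ ≤ G * (1 / 4) := mul_le_mul_of_nonneg_left hR₂K hG0
        _ = G / 4 := by ring
    have e3 : 3 * (CM * n * δ ^ (1 / 2 : ℝ) +
        K * (96 * A * (1 + Real.log (R / δ)) + 30 * G * R + 36 * C₀ * (Ce * e + R₂ * G) / R * vB / R ^ 3)) =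
        3 * (CM * n * δ ^ (1 / 2 : ℝ)) + 288 * K * A * (1 + Real.log (R / δ)) +
        108 * K * C₀ * vB * Ce * e / R ^ 4 + 3 * (K * (30 * G * R)) +
        3 * (K * (36 * C₀ * (R₂ * G) / R * vB / R ^ 3)) := by
      field_simp
      ring
    rw [e3] at hGle
    set T1 : ℝ := 3 * (K * (30 * G * R)) with hT1
    set T2 : ℝ := 3 * (K * (36 * C₀ * (R₂ * G) / R * vB / R ^ 3)) with hT2
    set a : ℝ := CM * n * δ ^ (1 / 2 : ℝ) with ha
    set b : ℝ := K * A * (1 + Real.log (R / δ)) with hb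
    set c : ℝ := K * C₀ * vB * Ce * e / R ^ 4 with hc
    clear_value T1 T2 a b c
    have e6 : 288 * K * A * (1 + Real.log (R / δ)) = 288 * b := by rw [hb]; ring
    have e7 : 108 * K * C₀ * vB * Ce * e / R ^ 4 = 108 * c := by rw [hc]; ring
    have e8 : 576 * K * A * (1 + Real.log (R / δ)) = 576 * b := by rw [hb]; ring
    have e9 : 216 * K * C₀ * vB * Ce * e / R ^ 4 = 216 * c := by rw [hc]; ring
    rw [e6, e7] at hGle
    rw [e8, e9]
    linarith
  -- the choice of `δ`
  have hfinal : G ≤ Cfin * (e + 1 + (1 + Real.posLog n) * A) := by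
    have hp0 : 0 ≤ Real.posLog (n : ℝ) := Real.posLog_nonneg
    have u1 : 6 * (CM * n * δ ^ (1 / 2 : ℝ)) ≤ 6 * CM := by
      have h := mul_le_mul_of_nonneg_left hnδ (by positivity : (0 : ℝ) ≤ 6 * CM)
      calc 6 * (CM * n * δ ^ (1 / 2 : ℝ)) = 6 * CM * ((n : ℝ) * δ ^ (1 / 2 : ℝ)) := by ring
        _ ≤ 6 * CM * 1 := h
        _ = 6 * CM := mul_one _
    have u2 : 576 * K * A * (1 + Real.log (R / δ)) ≤ 1152 * K * (1 + Real.log 4) * ((1 + Real.posLog n) * A) := by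
      have h1 : 1 + Real.log (R / δ) ≤ 2 * (1 + Real.log 4) * (1 + Real.posLog n) := by
        linarith [mul_nonneg hp0 hlog4, hlogδ]
      have h2 : 0 ≤ 576 * K * (A : ℝ) := by positivity
      calc 576 * K * A * (1 + Real.log (R / δ)) ≤ 576 * K * A * (2 * (1 + Real.log 4) * (1 + Real.posLog n)) :=
            mul_le_mul_of_nonneg_left h1 h2
        _ = 1152 * K * (1 + Real.log 4) * ((1 + Real.posLog n) * A) := by ring
    rw [hCfin]
    have f1 : 0 ≤ (e : ℝ) := e.coe_nonneg
    have f2 : 0 ≤ (1 + Real.posLog n) * (A : ℝ) := by positivity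
    have k1 : 0 ≤ 6 * (CM : ℝ) := by positivity
    have k2 : 0 ≤ 1152 * K * (1 + Real.log 4) := by positivity
    have k3 : 0 ≤ 216 * K * C₀ * vB * Ce / R ^ 4 := by positivity
    have c1 := mul_nonneg k1 (add_nonneg f1 f2)
    have c2 := mul_nonneg k2 (add_nonneg f1 (zero_le_one (α := ℝ)))
    have c3 := mul_nonneg k3 (add_nonneg (zero_le_one (α := ℝ)) f2)
    have e4 : (6 * CM + 1152 * K * (1 + Real.log 4) + 216 * K * C₀ * vB * Ce / R ^ 4) * (e + 1 + (1 + Real.posLog n) * A) =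
        (6 * CM + 1152 * K * (1 + Real.log 4) * ((1 + Real.posLog n) * A) + 216 * K * C₀ * vB * Ce / R ^ 4 * e) +
        (6 * CM * (e + (1 + Real.posLog n) * A) + 1152 * K * (1 + Real.log 4) * (e + 1) +
          216 * K * C₀ * vB * Ce / R ^ 4 * (1 + (1 + Real.posLog n) * A)) := by ring
    rw [e4]
    have e5 : 216 * K * C₀ * vB * Ce * e / R ^ 4 = 216 * K * C₀ * vB * Ce / R ^ 4 * e := by ring
    rw [e5] at hGabs
    linarith
  exact (hG x hx).trans hfinal

/-- **Discharge of `ShirotaYanagisawa1993_periodicCylinderLogEstimate`** (Shirota–Yanagisawa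
1993, (15) with (17), p. 80: the logarithmic `W^{1,∞}` bound for a *solution*, with the energy of
the datum): the stationary estimate just proved and the conservation of energy
(`ShirotaYanagisawa1993_periodicCylinderLogEstimate_of_divCurl`, `Ferrari1993LogEstimateReduction`).
[cite: ShirotaYanagisawa1993, (15) and (17) p. 80] -/
theorem ShirotaYanagisawa1993_periodicCylinderLogEstimate_holds :
    ShirotaYanagisawa1993_periodicCylinderLogEstimate :=
  ShirotaYanagisawa1993_periodicCylinderLogEstimate_of_divCurl
    ShirotaYanagisawa1993_periodicCylinderLogDivCurlEstimate_holds

end Literature.Analysis.FluidPDE
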